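import Summits.QuantumFields.YangMills.Theorems.BalabanUVNodesN14YoungRateLiaison
import Summits.QuantumFields.YangMills.Theorems.BalabanUVNodesN19InEdgesC1

/-!
# BalabanUVNodes ∕ node N14 = NE1′ — ROAD (ii)'s BY-NAME CAPSTONE WITH N16's LIAISON IN THE η-NORMALISED C¹ CURRENCY (the C¹ twin of
# `N14YoungRateLiaison.tiltedMeanMatching_summable_of_ratesAt_byName`; lens row LC-2′ = the N14 twin of LC-2 — LIFT of the lens seat's sketch)

Cell `pub-ymgap`, HUMAN RULING D-0062 (Track A), nodes N14 = NE1′ (road (ii)) and N19 = NE7; typed by R134 seat dag-n19-c (g4) WITH THE N14 LINEAGE's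
CONSENT (dag-n14-c g4, `pub-ymgap` INBOX l.14431: «please FILE LC-2′ … n14-c g4 does NOT type it; one declarer»); the capstone of record
`Theorems/BalabanUVNodesN14YoungRateLiaison.lean` (dag-n14-e g0, p456457) is NOT edited — this is a sibling.  FAN-OUT row LC-2′ of the lens «decomp» v3
(`run/shared/lean/pub/pub-ymgap/ym-lens-BalabanUVNodes-decomp/LENS-decomp.md` 60e8ecb91a5fad79 §v3.1 O1 audit, card M13, §v3.5).  AUTHORSHIP: the theorem
below is the lens seat's `YMLens.DecompNE7v3.tiltedMeanMatching_summable_of_ratesAt_byNameC1` (sketch `…/lean/LensDecompNE7v3.sketch.lean` 8f522b727d3c8177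
§E, farm rc 0 ∕ 0 sorry ∕ 0 warning 22:36Z; planner-ym-lens-BalabanUVNodes-decomp-g3) LIFTED VERBATIM — statement and proof token for token; namespace and
this header new.  Route `Summits/QuantumFields/YangMills/Theses/BalabanUVNodes.lean` rev 15, cluster item K3′ «SpineGivenEndpointR12» (stmt-QuantumFields-
19908); filed `--supports` that item `--as helper`.  COUNT-NEUTRAL.

O1 AUDIT (lens v3 §v3.1, numbers not adjectives).  Road (ii)'s by-name capstone `N14YoungRateLiaison.tiltedMeanMatching_summable_of_ratesAt_byName`
(:289–:359) obtains N16's liaison letters by the SAME call `N19InEdgesAtRecord.ne3Liaison_of_covRoot … hθ₃L hθ₃θ hθ₃1 … hdomc` as road (i)'s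
`N19RateEdgeTube.rateEdge_of_linkReading_byName_pairDisc` — plain-`sup‖Z‖` domination `hdomc`, the floor `θ⁸ ≤ θ₃` and the unused `L⁻¹ ≤ θ₃` —, and its
argument bracket is the same (T) `LipBackground R.u3.EA R.u3.W R.u3.κ CU` + `PolyLipGrowth CU g P q` over the same `R.u3` carriers.  Hence the lens's
located incoherence holds VERBATIM on road (ii): the printed analyticity chart ([Balaban1987RG1] (1.13) p. 262; [Balaban1988Convergent] (2.27)(ii)+(2.28)
p. 259) and the plain-sup liaison are `L^{2j}` apart, so `PolyLipGrowth` is refuted for the forced geometric modulus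
(`N19InEdgesC1.not_polyLipGrowth_of_geometric`).  The repair is the one road (i) received in `N19RateEdgeTubeC1` (p475545): the η-NORMALISED C¹
convention `hdomC1` with the floor `θ ≤ θ₃`, delivered by `N19InEdgesC1.ne3LiaisonC1_of_covRoot` (LC-1, p469304).

WHAT THIS FILE PROVES.  **`tiltedMeanMatching_summable_of_ratesAt_byNameC1`** — the by-name capstone with EXACTLY three changes in its N16 block:
`hθ₃L : L⁻¹ ≤ θ₃` DROPPED; the floor `hθ₃θ : θ ≤ θ₃` (was `θ ^ 8 ≤ θ₃`); the domination convention `hdomC1` (two weighted premises —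
`(R.ne3.L)^{k₀+K}·‖Z x κ‖ ≤ M` and `((R.ne3.L)^{k₀+K})²·‖Ad(rescale L (bavg L (sel (k₀+K+1) (rd v))) (x + e κ) μ)(Z (x + e μ) κ) − Z x κ‖ ≤ M` ⇒
`R.u3.C.gauge (uA K v) (R.u3.C.transport (uB K v)) ≤ M`; (Gᶜ) CONSUMED).  PROOF: `N19InEdgesC1.ne3LiaisonC1_of_covRoot` ∘
`N14YoungRate.tiltedMeanMatching_summable_of_ratesAt_liaison` (three lines).  The downstream order facts `θ₃ ≤ ρ′ < 1`, `ρ′ ≤ R.ne1.Λ` are untouched —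
the weaker floor costs nothing (the crossover is summable for every `ρ′ < 1`).  SAME conclusion `∃ η, TiltedMeanMatching l₀ T Bad F ν F′ ν′ η ∧ Summable η`.

HONEST FRAMING.  Count-neutral bookkeeping by name; NE1′ ∕ NE3 ∕ NE7 NOT PRINTED as two-run statements and NOT proved (`RatesAt Dt R`, `ReadOutAt`, the
`ScaleLedger`, the one-run identifications, `hdomU`, `hdomC1`, (T) are HYPOTHESES); nothing of Bałaban's is asserted beyond the chart LOCATORS quoted for
shape; N14 ∕ N16 ∕ N19 NOT discharged; Track A count unmoved (5∕27 · A 5∕28).  One finite four-torus at fixed ε, rung (B)+1 — NOT infinite volume, NOT OS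
on ℝ⁴, NOT a mass gap, NOT Clay.  THEOREMS ONLY; 0 `def`; 0 `sorry`; standard axioms.  No decl below carries a cite tag.
-/

set_option autoImplicit false

noncomputable section

open scoped BigOperators Matrix Matrix.Norms.L2Operator
open Finset MeasureTheory

namespace YMDAG.N14YoungRateC1

open Literature.MathematicalPhysics.QuantumFieldTheory.Balaban1983to89
open T4OutputRate (Carriers Functional LipBackground)
open T4TowerRateComposition (PolyLipGrowth)
open T4RecentScale (Multiplicity)

/-! ## §1 Road (ii)'s by-name capstone with N16's liaison in the η-normalised C¹ currency (lens row LC-2′ = the N14 twin of LC-2) -/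

section RoadTwoC1

open T4EtaRateMin (Readings NE3Shape)
open T4RateLiaison (GaugeDominated)
open T4CouplingMatching (EventualLowerH)
open FlowStep (RGEqH)
open B7Prop1Explicit B7Prop2Explicit
open T4AveragingDeficitWall (IsSkewDir vary Ad)
open Summit.QuantumFields.BalabanUV.T4Continuum
open Summit.QuantumFields.BalabanUV.T4Continuum.NE1p.DressedMGFForm (TiltedMeanMatching)
open Summit.QuantumFields.BalabanUV.T4Continuum.NE1p.TiltedMeanCrossover (ScaleLedger)
open AveragingDeficitDualResidual (dualC1 dualC2)
open AveragingDeficitDerivWallProof (wallConst)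
open AveragingDeficitPeriodicCounting (IsPeriodicDir)
open MinimalActionSandwich (IsMinimiser minAct)
open MinimalActionRate (sfClass)
open MinimalActionRefine (RegularSup gradConst)
open NE3EnergyShapes (IsUnitarySite IsPeriodicSite)
open NE3.LeafIndexSockets (LeafH3sup)
open Summit.QuantumFields.YangMills.BalabanUVNodes.N19InEdgesC1 (ne3LiaisonC1_of_covRoot)
open YMDAG.N14YoungRate (tiltedMeanMatching_summable_of_ratesAt_liaison)
open YMDAG.UVSplit (U3Carriers RateCarriers ReadOutAt RatesAt)

variable {Fam : T4Continuum.T4Family} {N : ℕ} [NeZero N] {ι D : Type*} [DecidableEq ι] {Ω Ω' : ℕ → Type*}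
  [∀ K, MeasurableSpace (Ω K)] [∀ K, MeasurableSpace (Ω' K)] {l₀ vol : ℝ} {T : ℕ → Finset ι} {Bad : ℕ → ℝ → Finset ι}
  {F : ∀ K, Ω K → ℝ} {ν : ∀ K, ι → Measure (Ω K)} {F' : ∀ K, Ω' K → ℝ} {ν' : ∀ K, ι → Measure (Ω' K)} {wf : ℕ → ι → Finset D}
  {sc : ℕ → D → ℕ} {bA bB : ℕ → ℝ → ι → ℝ → ℝ} {ΔA ΔB : ℕ → ℝ → ι → ℝ → D → ℝ} {w : ℕ → ℝ}

/-- **ROAD (ii) BY NAME IN THE C¹ CURRENCY** — `N14YoungRateLiaison.tiltedMeanMatching_summable_of_ratesAt_byName` with exactly three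
changes: the gauge-domination convention is `hdomC1` (η-normalised C¹ chart size of the N16 witness field dominates the U3 gauge distance —
the (Gᶜ) face of N16's C¹ output, consumed instead of discarded), the target-rate floor is `θ ≤ θ₃` (not `θ⁸ ≤ θ₃`),
and `L⁻¹ ≤ θ₃` is dropped.  PROVED: `N19InEdgesC1.ne3LiaisonC1_of_covRoot` ∘ `tiltedMeanMatching_summable_of_ratesAt_liaison`.  With this
currency the (T) letters `LipBackground … CU`, `PolyLipGrowth CU g P q` are an honest instance of [I] (1.13) (n19-c's
`N19LipBracketTubeLine.lipBracket_at_rateCarriers_of_tubeLine`).  NOT NE7 ∕ NE3 ∕ NE1′; nothing of N14 ∕ N16 ∕ N07 is proved. [bookkeeping] -/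
theorem tiltedMeanMatching_summable_of_ratesAt_byNameC1 (Dt : YMDAG.UVSplit.Datum Fam N) (R : RateCarriers N)
    (hrates : RatesAt Dt R) (hD4 : ReadOutAt Dt R.u3)
    (hL : ScaleLedger l₀ T Bad F ν F' ν' wf sc bA bB ΔA ΔB w) (wt : ℕ → ι → D → ℝ)
    (hwt : ∀ K τ, ∀ X ∈ wf K τ, 0 ≤ wt K τ X) {Cw : ℝ} (hCw : 0 ≤ Cw)
    (hM : ∀ K, ∀ τ ∈ T K, Multiplicity (wf K τ) (sc K) (wt K τ) Cw vol R.ne1.Λ K)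
    (pA : ℕ → ℝ → ℝ → R.ne1.P) (KA : ℕ → ℕ)
    (βA : ∀ (K : ℕ) (t : ℝ) (τ : ι) (s : ℝ), D → (R.ne1.𝒯.B (pA K t s) (KA K)).Birth)
    (hscA : ∀ K t τ s, ∀ X ∈ wf K τ, KA K - (R.ne1.𝒯.B (pA K t s) (KA K)).birthScale (βA K t τ s X) = K - sc K X)
    (hdomA : ∀ K (t : ℝ), |t| ≤ l₀ → ∀ τ ∈ T K \ Bad K t, ∀ s : ℝ, |s| ≤ l₀ → ∀ X ∈ wf K τ,
      |ΔA K t τ s X| ≤ (R.ne1.𝒯.B (pA K t s) (KA K)).size (βA K t τ s X) (KA K) * wt K τ X)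
    (pB : ℕ → ℝ → ℝ → R.ne1.P) (KB : ℕ → ℕ)
    (βB : ∀ (K : ℕ) (t : ℝ) (τ : ι) (s : ℝ), D → (R.ne1.𝒯.B (pB K t s) (KB K)).Birth)
    (hscB : ∀ K t τ s, ∀ X ∈ wf K τ, KB K - (R.ne1.𝒯.B (pB K t s) (KB K)).birthScale (βB K t τ s X) = K - sc K X)
    (hdomB : ∀ K (t : ℝ), |t| ≤ l₀ → ∀ τ ∈ T K \ Bad K t, ∀ s : ℝ, |s| ≤ l₀ → ∀ X ∈ wf K τ,
      |ΔB K t τ s X| ≤ (R.ne1.𝒯.B (pB K t s) (KB K)).size (βB K t τ s X) (KB K) * wt K τ X)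
    {g : ℕ → ℕ → ℝ} {gIR bβ : ℝ} {k₀β : ℕ} (hγ : 0 < R.u3.γ) (hbβ : 0 < bβ) (hρ0 : 0 < R.u3.ρ) (hρ1 : R.u3.ρ < 1)
    (hrun : ∀ K, RGEqH K Dt.βfun (g K)) (hbox : ∀ K i, i ≤ K → 0 < g K i ∧ g K i ≤ R.u3.γ) (hpin : ∀ K, g K K = gIR)
    (hlo : EventualLowerH bβ R.u3.γ k₀β Dt.βfun)
    (hsmall : R.u3.cr * R.u3.C₉ * R.u3.ω * (((k₀β : ℝ) + 1) * R.u3.γ ^ 3 + 2 * R.u3.γ / bβ) ≤ (1 - R.u3.ρ) / 2)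
    (hgW : ∀ K, g K ∈ R.u3.W) (hgW' : ∀ K, (fun i => g (K + 1) (i + 1)) ∈ R.u3.W)
    (bsel : (ℕ → ℝ) → ℝ) (hb : ∀ s ∈ R.u3.W, 0 < bsel s ∧ bsel s ≤ R.u3.γ)
    {CU : (ℕ → ℝ) → ℕ → ℝ} (hU : LipBackground R.u3.EA R.u3.W R.u3.κ CU) {P : ℝ} {q : ℕ} (hG : PolyLipGrowth CU g P q)
    (hP : 0 ≤ P) (hκ : 0 ≤ R.u3.κ)
    -- N16 BY NAME (as in `…_byName`), WITHOUT `hθ₃L`, with the floor `θ ≤ θ₃`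
    {c' t ε₁ θ γ₃ l₁ θ₃ : ℝ} (hg3 : R.ne3.g = gradConst 4 c') (hL2 : 2 ≤ R.ne3.L) (hNper : 1 ≤ R.ne3.Nper) (hb3 : 0 ≤ R.ne3.b)
    (hc' : 0 ≤ c') (hbt : R.ne3.b ≤ t) (hct : c' ≤ t) (hC3 : 0 ≤ R.ne3.C) (hsmall3 : (2 : ℝ) ^ 91 * (R.ne3.L : ℝ) ^ 17 * t ≤ 1)
    (hεt : (2 : ℝ) ^ 76 * (R.ne3.L : ℝ) ^ 12 * t ≤ R.ne3.ε) (hε1 : 16 * B7Prop2Explicit.C0 4 * R.ne3.ε ≤ 3)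
    (hε2 : 1024 * (4 + 1) * (4 + 4) * (R.ne3.L : ℝ) ^ 2 * R.ne3.ε ≤ 1) (hε₁ : ε₁ ≤ 1 / 4) (hε₁b : ε₁ ≤ R.ne3.b) (hε₁c : 4 * ε₁ ≤ c')
    (hdom3 : R.ne3.dom ⊆ sfClass 4 R.ne3.L R.ne3.Nper ε₁ 0) (hH3 : LeafH3sup 4 R.ne3.L R.ne3.Nper R.ne3.ε R.ne3.b c' R.ne3.dom)
    (sel : ℕ → (Site 4 → Fin 4 → (Matrix (Fin N) (Fin N) ℂ)ˣ) → (Site 4 → Fin 4 → (Matrix (Fin N) (Fin N) ℂ)ˣ))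
    (hsel : ∀ V ∈ R.ne3.dom, ∀ k : ℕ, IsMinimiser 4 (sfClass 4 R.ne3.L R.ne3.Nper R.ne3.ε) R.ne3.L R.ne3.Nper k V (sel k V))
    (hreg : ∀ V ∈ R.ne3.dom, ∀ k : ℕ, RegularSup 4 R.ne3.L R.ne3.Nper R.ne3.b c' k (sel k V))
    (hθ0 : 0 < θ) (hθ6 : θ ^ 6 = ((R.ne3.L : ℝ))⁻¹) (hΛ₂' : 0 < R.ne3.Λ₂') (hγ₃ : 0 < γ₃)
    (hγ3 : R.ne3.C * (wallConst 4 R.ne3.L * (R.ne3.Nper : ℝ) ^ 2 *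
      (Real.sqrt (gradConst 4 c') * dualC2 4 R.ne3.L + 2 * R.ne3.b ^ 2 * dualC1 4 R.ne3.L)) ≤ γ₃ ^ 3)
    (hl₁ : 0 < l₁) (hΛl₁ : R.ne3.Λ₁ ≤ l₁ ^ 3) (hfit : γ₃ * θ ^ 2 ≤ l₁ * R.ne3.Nper)
    (hθ₃θ : θ ≤ θ₃) (hθ₃1 : θ₃ < 1)
    {ι' X' : Type} (Rd : Readings ι' X') (rd : ι' → (Site 4 → Fin 4 → (Matrix (Fin N) (Fin N) ℂ)ˣ))
    (hrd : ∀ v ∈ Rd.dom, rd v ∈ R.ne3.dom)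
    (hact : ∀ k, ∀ v ∈ Rd.dom, Rd.act k v = minAct 4 (sfClass 4 R.ne3.L R.ne3.Nper R.ne3.ε) R.ne3.L R.ne3.Nper k (rd v))
    (hvol3 : (R.ne3.Nper : ℝ) ^ 4 ≤ Rd.vol) (uA : ℕ → ι' → R.u3.C.BgA) (uB : ℕ → ι' → R.u3.C.BgB) {k₀ : ℕ} (hk₀ : 1 ≤ k₀)
    -- THE C¹ GAUGE-DOMINATION CONVENTION (LC-2's `hdomC1`, verbatim from `N19InEdgesC1.ne3LiaisonC1_of_covRoot` at `R.ne3`'s letters)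
    (hdomC1 : ∀ K : ℕ, ∀ v ∈ Rd.dom, ∀ (u : Site 4 → (Matrix (Fin N) (Fin N) ℂ)ˣ)
      (Z : Site 4 → Fin 4 → Matrix (Fin N) (Fin N) ℂ) (M : ℝ),
      IsUnitarySite u → IsPeriodicSite u ((R.ne3.Nper * R.ne3.L ^ (k₀ + K) : ℕ) : ℤ) → IsSkewDir Z →
      IsPeriodicDir Z ((R.ne3.Nper * R.ne3.L ^ (k₀ + K) : ℕ) : ℤ) →
      gaugeAct u (sel (k₀ + K) (rd v)) = vary (rescale R.ne3.L (bavg R.ne3.L (sel (k₀ + K + 1) (rd v)))) Z 1 →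
      (∀ (x : Site 4) (κ : Fin 4), (R.ne3.L : ℝ) ^ (k₀ + K) * ‖Z x κ‖ ≤ M) →
      (∀ (x : Site 4) (μ κ : Fin 4), ((R.ne3.L : ℝ) ^ (k₀ + K)) ^ 2 *
          ‖Ad (rescale R.ne3.L (bavg R.ne3.L (sel (k₀ + K + 1) (rd v))) (x + e κ) μ) (Z (x + e μ) κ) - Z x κ‖ ≤ M) →
      R.u3.C.gauge (uA K v) (R.u3.C.transport (uB K v)) ≤ M)
    -- the rate of the young half
    {ρ' : ℝ} (hρ' : max R.u3.ω R.u3.ρ < ρ') (hθ₃ρ : θ₃ ≤ ρ') (hρ'1 : ρ' < 1) (hρ'Λ : ρ' ≤ R.ne1.Λ)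
    -- the slots' U3 domains and the uniform two-run domination
    (δ : ∀ (K : ℕ) (t : ℝ) (τ : ι) (s : ℝ), D → R.u3.C.Dom)
    (hδ : ∀ K t τ s, ∀ X ∈ wf K τ, R.u3.C.scale (δ K t τ s X) = sc K X)
    (hdomU : ∀ K (t : ℝ), |t| ≤ l₀ → ∀ τ ∈ T K \ Bad K t, ∀ s : ℝ, |s| ≤ l₀ → ∀ X ∈ wf K τ, ∀ M : ℝ, 0 ≤ M →
      (∀ v ∈ Rd.dom, |R.u3.EA (g K) (uA K v) (δ K t τ s X)
          - R.u3.EB (bsel fun i => g (K + 1) (i + 1)) (fun i => g (K + 1) (i + 1)) (uB K v) (δ K t τ s X)| ≤ M) →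
      |ΔB K t τ s X - ΔA K t τ s X| ≤ wt K τ X * M)
    (hvol : 0 ≤ vol) (hws : Summable w) :
    ∃ η : ℕ → ℝ, TiltedMeanMatching l₀ T Bad F ν F' ν' η ∧ Summable η := by
  haveI : Nonempty (Fin N) := ⟨⟨0, Nat.pos_of_ne_zero (NeZero.ne N)⟩⟩
  -- N16 from `RatesAt Dt R` by name, read with `R.ne3.g = gradConst 4 c′`
  have h16 : NE3EnergyWeightedCovShape.NE3EnergyRateWCov 4 (sfClass 4 R.ne3.L R.ne3.Nper R.ne3.ε) R.ne3.L R.ne3.Nper R.ne3.b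
      (gradConst 4 c') R.ne3.C R.ne3.Λ₁ R.ne3.Λ₂' R.ne3.dom := by
    rw [← hg3]; exact hrates.2.2.1
  -- the liaison letters IN THE C¹ CURRENCY (tree: `N19InEdgesC1.ne3LiaisonC1_of_covRoot`, p469304)
  obtain ⟨C₃, loc, hC₃, h3, hgd⟩ :=
    ne3LiaisonC1_of_covRoot (n := Fin N) hL2 hNper hb3 hc' hbt hct hC3 hsmall3 hεt hε1 hε2 hε₁ hε₁b hε₁c hdom3 h16 hH3 sel hsel hreg
      hθ0 hθ6 hΛ₂' hγ₃ hγ3 hl₁ hΛl₁ hfit hθ₃θ hθ₃1 Rd rd hrd hact hvol3 uA uB hk₀ hdomC1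
  exact tiltedMeanMatching_summable_of_ratesAt_liaison Dt R hrates hD4 hL wt hwt hCw hM pA KA βA hscA hdomA pB KB βB hscB hdomB
    hγ hbβ hρ0 hρ1 hrun hbox hpin hlo hsmall hgW hgW' bsel hb hU hG hP hκ
    (⟨Rd.dom, Rd.act, loc, Rd.vol, Rd.vol_nonneg⟩ : Readings ι' Unit) h3 hC₃ hgd hρ' hθ₃ρ hρ'1 hρ'Λ δ hδ hdomU hvol hws

end RoadTwoC1

end YMDAG.N14YoungRateC1

end
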